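import Summits.QuantumAdvantage.QuantumAdvantage.Theorems.GapDialFeedback

/-!
# GapDial (3/4) — THE DILUTION LAW and the PROVED dial points `2^{-n/2}`, `2^{-√n}`

DILUTION: the block matrix `M = E_w ⊕ δ_j` (`blockDiag`; `j` idle coordinates on which `I + M` is the identity) keeps the feedback value —
`sum_solutions_pad`, `value_qpad : Φ(qpad w) = -2^{-kk m} · (-1)^{[3 ∣ |w|]}` — while the arity becomes `n = 2·KK m = 2(kk m + (kk m)²)`;
the code is still a literal projection of polynomial length (`isProj_encode_qpad`, `uPoly₂`, `length_encode_qpad_le`), so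
`gapSlice_not_mem_AC0Mod_of_small₂ : (∀ m, δ (2·KK m) ≤ 2^{-kk m}) → GapSlice δ ∉ promiseLift (AC0Mod p)` (`p ≠ 3`).
MAIN THEOREMS: `gapSlice_invSqrt_not_mem : GapSlice (n ↦ 2^{-(n/2)}) ∉ promiseLift (AC0Mod 2)`,
`gapSlice_invExpSqrt_not_mem : GapSlice (n ↦ 2^{-⌊√n⌋}) ∉ promiseLift (AC0Mod 2)`, `gapSlice_invSqrt_not_mem_AC0Mod (p.Prime) (p ≠ 3)`,
`gapSlice_not_mem_of_le_invSqrt` (every `δ ≤ 2^{-(n/2)}` pointwise), the `AC⁰[⊕] ∩ P` versions, `gapSlice_min_threeFifths_invSqrt_not_mem`,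
and `dial_calibration` (proved points + the EQUIV with item 27991 + antitonicity in one statement).
HONEST CEILING: the planting cannot reach constant gap (with gap `≥ 2^{-polylog n}` the planted predicate lives on `polylog n` effective bits and is
in `AC⁰`); the constant-gap rung `δ = 3/5` is open and necessary for 27991 (part 1 `GapDialSlice`).  [this lineage g9]
-/

set_option linter.dupNamespace false

noncomputable section


namespace Summit.QuantumAdvantage.QuantumAdvantage.Theorems.GapDial

open Finset
open Literature.Computability.Complexity
open Literature.Computability.QuantumComplexity
open Literature.Computability.MetaComplexity
open _root_.Computability (encodeNat)
open Summit.QuantumAdvantage.QuantumAdvantage.Theorems.HintDial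

set_option linter.unusedVariables false
set_option linter.unusedSectionVars false

namespace Automaton

open CubicForm (bit)
open BuzetChailloux (bxor zeroVec)
open Summit.QuantumAdvantage.QuantumAdvantage.Theorems.HintDial.Automaton

variable {m : ℕ} (w : Fin m → Bool)

/-! ### ★ THE DILUTION LAW: idle EXACT coordinates keep the value — `M = E_w ⊕ I_j` gives `|Φ| = 2^{-k}` on `n = 2(k+j)` variables

With `j` extra coordinate pairs on which both tables carry the inner product (`M = E_w ⊕ I_j`, so `I + M = N_w ⊕ 0_j`), the
solution set of `(I+M)x″ = e_a` is the coset `x* × 𝔽₂^j` and the readout is constant on it: `Φ = -2^{-K}·2^{j}·(-1)^{x*_{b₀}} =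
∓2^{-k}` with `K = k + j`.  Taking `j = k²` plants `MOD₃` at gap `2^{-k} ≥ 2^{-√n}`: the PROVED region of the dial reaches `2^{-√n}`
(and, with `j = k^C`, `2^{-n^{1/C}}` for every `C` — same proof, not spelled out). -/

section Dilution

variable {k₁ k₂ : ℕ}

/-- block-diagonal pattern `M₁ ⊕ M₂`. -/
def blockDiag (M₁ : Fin k₁ → Fin k₁ → Bool) (M₂ : Fin k₂ → Fin k₂ → Bool) : Fin (k₁ + k₂) → (Fin (k₁ + k₂) → Bool) :=
  @Fin.addCases k₁ k₂ (fun _ => Fin (k₁ + k₂) → Bool) (fun a₁ => Fin.append (M₁ a₁) (fun _ => false))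
    (fun a₂ => Fin.append (fun _ => false) (M₂ a₂))

/-- GapDial helper `blockDiag_left` (lens-3 g9 GapDial THEOREMS package; see the enclosing section docstring). -/
theorem blockDiag_left (M₁ : Fin k₁ → Fin k₁ → Bool) (M₂ : Fin k₂ → Fin k₂ → Bool) (a₁ : Fin k₁) :
    blockDiag M₁ M₂ (Fin.castAdd k₂ a₁) = Fin.append (M₁ a₁) (fun _ => false) := by
  unfold blockDiag; rw [Fin.addCases_left]

/-- GapDial helper `blockDiag_right` (lens-3 g9 GapDial THEOREMS package; see the enclosing section docstring). -/
theorem blockDiag_right (M₁ : Fin k₁ → Fin k₁ → Bool) (M₂ : Fin k₂ → Fin k₂ → Bool) (a₂ : Fin k₂) :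
    blockDiag M₁ M₂ (Fin.natAdd k₁ a₂) = Fin.append (fun _ => false) (M₂ a₂) := by
  unfold blockDiag; rw [Fin.addCases_right]

/-- GapDial helper `bd_append` (lens-3 g9 GapDial THEOREMS package; see the enclosing section docstring). -/
theorem bd_append (p z : Fin k₁ → Bool) (q u : Fin k₂ → Bool) :
    bd (Fin.append p q) (Fin.append z u) = xor (bd p z) (bd q u) := by
  apply bit_injective
  rw [bit_xor, bit_bd, bit_bd, bit_bd, Fin.sum_univ_add]
  simp only [Fin.append_left, Fin.append_right]

/-- GapDial helper `mv_blockDiag` (lens-3 g9 GapDial THEOREMS package; see the enclosing section docstring). -/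
theorem mv_blockDiag (M₁ : Fin k₁ → Fin k₁ → Bool) (M₂ : Fin k₂ → Fin k₂ → Bool) (z : Fin k₁ → Bool) (u : Fin k₂ → Bool) :
    mv (blockDiag M₁ M₂) (Fin.append z u) = Fin.append (mv M₁ z) (mv M₂ u) := by
  funext i
  refine Fin.addCases (fun a₁ => ?_) (fun a₂ => ?_) i
  · rw [Fin.append_left, mv, blockDiag_left, bd_append, bd_zero_left, Bool.xor_false]; rfl
  · rw [Fin.append_right, mv, blockDiag_right, bd_append, bd_zero_left, Bool.false_xor]; rfl

/-- GapDial helper `bxor_append` (lens-3 g9 GapDial THEOREMS package; see the enclosing section docstring). -/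
theorem bxor_append (z p : Fin k₁ → Bool) (u q : Fin k₂ → Bool) :
    bxor (Fin.append z u) (Fin.append p q) = Fin.append (bxor z p) (bxor u q) := by
  funext i
  refine Fin.addCases (fun a₁ => ?_) (fun a₂ => ?_) i
  · simp only [bxor, Fin.append_left]
  · simp only [bxor, Fin.append_right]

/-- GapDial helper `sgl_castAdd` (lens-3 g9 GapDial THEOREMS package; see the enclosing section docstring). -/
theorem sgl_castAdd (a : Fin k₁) : sgl (Fin.castAdd k₂ a) = Fin.append (sgl a) (zeroVec : Fin k₂ → Bool) := by
  funext i
  refine Fin.addCases (fun a₁ => ?_) (fun a₂ => ?_) i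
  · simp only [sgl, Fin.append_left, Fin.castAdd_inj]
  · simp only [sgl, Fin.append_right, zeroVec]
    rw [decide_eq_false]
    intro h
    have := congrArg Fin.val h
    simp [Fin.natAdd, Fin.castAdd] at this
    omega

/-- GapDial helper `append_zeroVec_eq_iff` (lens-3 g9 GapDial THEOREMS package; see the enclosing section docstring). -/
theorem append_zeroVec_eq_iff (v v' : Fin k₁ → Bool) :
    Fin.append v (zeroVec : Fin k₂ → Bool) = Fin.append v' zeroVec ↔ v = v' := by
  constructor
  · intro h; funext i
    have := congrFun h (Fin.castAdd k₂ i)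
    rwa [Fin.append_left, Fin.append_left] at this
  · rintro rfl; rfl

/-- ★ THE DILUTED SOLUTION SUM: with `M = E_w ⊕ I_j` the solution set is `x* × 𝔽₂^j` and the readout is `2^j (-1)^{x*_{b₀}}`. -/
theorem sum_solutions_pad (j : ℕ) :
    ∑ x₂ : Fin (kk m + j) → Bool,
        (if bxor x₂ (mv (blockDiag (EE w) (dM : Fin j → Fin j → Bool)) x₂) = sgl (Fin.castAdd j a₀)
          then signOf (x₂ (Fin.castAdd j b₀)) else 0)
      = (2 : ℝ) ^ j * signOf (decide (GateFn.numOnes w % 3 = 0)) := by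
  rw [sum_append]
  simp_rw [mv_blockDiag, mv_dM, bxor_append, BuzetChailloux.bxor_self, bxor_mv_EE, sgl_castAdd, append_zeroVec_eq_iff,
    mv_QQ_eq_sgl_iff, Fin.append_left]
  rw [Finset.sum_comm]
  simp_rw [Finset.sum_ite_eq', Finset.mem_univ, if_true]
  rw [sum_const, card_univ, xstar_b₀, nsmul_eq_mul]
  congr 1
  simp

/-- `j = k²` idle pairs; `K = k + k²`. -/
abbrev KK (m : ℕ) : ℕ := kk m + kk m * kk m

/-- ★ the DILUTED planted instance on `n = 2(k + k²)` variables. -/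
def qpad : CubicANFPair :=
  ⟨KK m + KK m, FF (KK m) (blockDiag (EE w) (dM : Fin (kk m * kk m) → Fin (kk m * kk m) → Bool)) (Fin.castAdd _ b₀),
    GG (KK m) (Fin.castAdd _ a₀)⟩

/-- ★★ its value is STILL `∓2^{-k}` (dilution law). -/
theorem value_qpad : (qpad w).value = -((2 : ℝ) ^ kk m)⁻¹ * signOf (decide (GateFn.numOnes w % 3 = 0)) := by
  rw [qpad, value_feedback, sum_solutions_pad, pow_add]
  have h2 : (2 : ℝ) ^ kk m ≠ 0 := pow_ne_zero _ two_ne_zero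
  have h3 : (2 : ℝ) ^ (kk m * kk m) ≠ 0 := pow_ne_zero _ two_ne_zero
  field_simp

/-- GapDial helper `value_qpad_of_mod` (lens-3 g9 GapDial THEOREMS package; see the enclosing section docstring). -/
theorem value_qpad_of_mod (h : GateFn.numOnes w % 3 = 0) : (qpad w).value = ((2 : ℝ) ^ kk m)⁻¹ := by
  rw [value_qpad, decide_eq_true h, SgnForrMem.signOf_true]; ring

/-- GapDial helper `value_qpad_of_not_mod` (lens-3 g9 GapDial THEOREMS package; see the enclosing section docstring). -/
theorem value_qpad_of_not_mod (h : ¬ GateFn.numOnes w % 3 = 0) : (qpad w).value = -((2 : ℝ) ^ kk m)⁻¹ := by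
  rw [value_qpad, decide_eq_false h]; simp [signOf]

/-- GapDial helper `qpad_even` (lens-3 g9 GapDial THEOREMS package; see the enclosing section docstring). -/
theorem qpad_even : Even (qpad w).n := ⟨KK m, rfl⟩

/-- GapDial helper `qpad_mem_yes` (lens-3 g9 GapDial THEOREMS package; see the enclosing section docstring). -/
theorem qpad_mem_yes {δ : ℕ → ℝ} (hδ : δ (KK m + KK m) ≤ ((2 : ℝ) ^ kk m)⁻¹) (h : GateFn.numOnes w % 3 = 0) :
    (qpad w).encode ∈ (GapSlice δ).yes :=
  ⟨qpad w, ⟨qpad_even w, by rw [value_qpad_of_mod w h]; exact hδ⟩, rfl⟩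

/-- GapDial helper `qpad_mem_no` (lens-3 g9 GapDial THEOREMS package; see the enclosing section docstring). -/
theorem qpad_mem_no {δ : ℕ → ℝ} (hδ : δ (KK m + KK m) ≤ ((2 : ℝ) ^ kk m)⁻¹) (h : ¬ GateFn.numOnes w % 3 = 0) :
    (qpad w).encode ∈ (GapSlice δ).no :=
  ⟨qpad w, ⟨qpad_even w, by rw [value_qpad_of_not_mod w h]; exact neg_le_neg hδ⟩, rfl⟩

/-- GapDial helper `isLit_blockDiag_EE` (lens-3 g9 GapDial THEOREMS package; see the enclosing section docstring). -/
theorem isLit_blockDiag_EE (a b : Fin (KK m)) :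
    IsLit fun w : Fin m → Bool => blockDiag (EE w) (dM : Fin (kk m * kk m) → Fin (kk m * kk m) → Bool) a b := by
  refine Fin.addCases (motive := fun a => IsLit fun w : Fin m → Bool => blockDiag (EE w) dM a b) (fun a₁ => ?_) (fun a₂ => ?_) a
  · refine Fin.addCases (motive := fun b => IsLit fun w : Fin m → Bool => blockDiag (EE w) dM (Fin.castAdd _ a₁) b)
      (fun b₁ => ?_) (fun b₂ => ?_) b
    · exact (isLit_EE a₁ b₁).congr fun w => by rw [blockDiag_left, Fin.append_left]
    · exact (IsLit.const false).congr fun w => by rw [blockDiag_left, Fin.append_right]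
  · refine Fin.addCases (motive := fun b => IsLit fun w : Fin m → Bool => blockDiag (EE w) dM (Fin.natAdd _ a₂) b)
      (fun b₁ => ?_) (fun b₂ => ?_) b
    · exact (IsLit.const false).congr fun w => by rw [blockDiag_right, Fin.append_left]
    · exact (IsLit.const (dM a₂ b₂)).congr fun w => by rw [blockDiag_right, Fin.append_right]

/-- GapDial helper `isProj_encode_qpad` (lens-3 g9 GapDial THEOREMS package; see the enclosing section docstring). -/
theorem isProj_encode_qpad : IsProj fun w : Fin m → Bool => (qpad w).encode := by
  unfold CubicANFPair.encode
  exact (IsProj.const (encodeNat (KK m + KK m))).boolPair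
    ((isProj_encode_form (fun w => FF (KK m) (blockDiag (EE w) dM) (Fin.castAdd _ b₀)) false (fun _ => rfl)
        (isLit_FF_cube (fun w => blockDiag (EE w) dM) isLit_blockDiag_EE _)).boolPair
      (isProj_encode_form (fun _ => GG (KK m) (Fin.castAdd _ a₀)) true (fun _ => rfl) fun _ _ _ => IsLit.const _))

/-- the length-bounding polynomial of the diluted family (`n = 2((3m+3) + (3m+3)²)`). -/
def uPoly₂ : Polynomial ℕ :=
  (Polynomial.C 12 * Polynomial.X ^ 3 + Polynomial.C 12 * Polynomial.X ^ 2 + Polynomial.C 8 * Polynomial.X + Polynomial.C 16).comp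
    (Polynomial.C 2 * ((Polynomial.C 3 * Polynomial.X + Polynomial.C 3) +
      (Polynomial.C 3 * Polynomial.X + Polynomial.C 3) * (Polynomial.C 3 * Polynomial.X + Polynomial.C 3)))

/-- GapDial helper `uPoly₂_eval` (lens-3 g9 GapDial THEOREMS package; see the enclosing section docstring). -/
theorem uPoly₂_eval (j : ℕ) : uPoly₂.eval j = lenB (2 * ((3 * j + 3) + (3 * j + 3) * (3 * j + 3))) := by
  simp [uPoly₂, lenB]

/-- GapDial helper `length_encode_qpad_le` (lens-3 g9 GapDial THEOREMS package; see the enclosing section docstring). -/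
theorem length_encode_qpad_le : (qpad w).encode.length ≤ uPoly₂.eval m := by
  rw [uPoly₂_eval]
  refine (length_encode_pair_le _).trans (le_of_eq ?_)
  show lenB (KK m + KK m) = _
  congr 1; simp only [KK, kk]; ring

/-- ★★ THE DILUTED PLANTING THEOREM: every gap function with `δ(2(k+k²)) ≤ 2^{-k}` along the planted arities holds against `AC⁰[p]`,
`p ≠ 3`. -/
theorem gapSlice_not_mem_AC0Mod_of_small₂ {p : ℕ} (hp : p.Prime) (hp3 : p ≠ 3) {δ : ℕ → ℝ}
    (hδ : ∀ m : ℕ, δ (KK m + KK m) ≤ ((2 : ℝ) ^ kk m)⁻¹) : GapSlice δ ∉ promiseLift (AC0Mod p) :=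
  not_promiseLift_AC0Mod_of_proj hp Nat.prime_three hp3 (GapSlice δ) (fun _ w => (qpad w).encode)
    (fun _ => isProj_encode_qpad) uPoly₂ (fun _ w => length_encode_qpad_le w)
    (fun m w h => qpad_mem_yes w (hδ m) h) (fun m w h => qpad_mem_no w (hδ m) h)

end Dilution

end Automaton

/-! ### ★★ THE PROVED DIAL POINTS -/

section Proved

/-- the gap function `2^{-⌊n/2⌋}`. -/
def invSqrt (n : ℕ) : ℝ := ((2 : ℝ) ^ (n / 2))⁻¹

/-- ★★ gap `2^{-n/2}` is HARD: the signed (quadratic ⊂) cubic Forrelation sign problem with promise gap `2^{-n/2}`, both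
tables given in full, is not in `promiseLift AC⁰[⊕]` (kernel-checked; Smolensky + the feedback planting). -/
theorem gapSlice_invSqrt_not_mem : GapSlice invSqrt ∉ promiseLift (AC0Mod 2) :=
  Automaton.gapSlice_not_mem_of_small fun m => by
    have e : (Automaton.kk m + Automaton.kk m) / 2 = Automaton.kk m := by omega
    simp only [invSqrt, e]; exact le_rfl

/-- the gap function `2^{-⌊√n⌋}`. -/
def invExpSqrt (n : ℕ) : ℝ := ((2 : ℝ) ^ Nat.sqrt n)⁻¹

/-- ★★ gap `2^{-√n}` is HARD (dilution law, `j = k²` idle exact pairs): the proved region of the dial reaches the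
sub-exponential gap `2^{-√n}`. -/
theorem gapSlice_invExpSqrt_not_mem : GapSlice invExpSqrt ∉ promiseLift (AC0Mod 2) :=
  Automaton.gapSlice_not_mem_AC0Mod_of_small₂ Nat.prime_two (by decide) fun m => by
    unfold invExpSqrt
    have hk : Automaton.kk m ≤ Nat.sqrt (Automaton.KK m + Automaton.KK m) := by
      rw [Nat.le_sqrt]
      show Automaton.kk m * Automaton.kk m ≤ Automaton.kk m + Automaton.kk m * Automaton.kk m + (Automaton.kk m + Automaton.kk m * Automaton.kk m)
      omega
    exact inv_anti₀ (pow_pos two_pos _) (pow_le_pow_right₀ one_le_two hk)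

/-- the same two theorems for every prime `p ≠ 3` (Smolensky `MOD₃ ∉ AC⁰[p]`); for ODD `p` the whole dial up to `δ = 1` is in
fact decided by g6's parity planting of the EXACT slice (not repeated here). -/
theorem gapSlice_invSqrt_not_mem_AC0Mod {p : ℕ} (hp : p.Prime) (hp3 : p ≠ 3) : GapSlice invSqrt ∉ promiseLift (AC0Mod p) :=
  Automaton.gapSlice_not_mem_AC0Mod_of_small hp hp3 fun m => by
    have e : (Automaton.kk m + Automaton.kk m) / 2 = Automaton.kk m := by omega
    simp only [invSqrt, e]; exact le_rfl

/-- every gap below `2^{-n/2}` is a PROVED rung (dial law 2), -/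
theorem gapSlice_not_mem_of_le_invSqrt {δ : ℕ → ℝ} (hδ : ∀ n, δ n ≤ invSqrt n) : GapSlice δ ∉ promiseLift (AC0Mod 2) :=
  gapSlice_not_mem_anti hδ gapSlice_invSqrt_not_mem

/-- in particular against the uniform class `AC⁰[⊕] ∩ P` of the crux `RungA`. -/
theorem gapSlice_not_mem_inter_P_of_le_invSqrt {δ : ℕ → ℝ} (hδ : ∀ n, δ n ≤ invSqrt n) :
    GapSlice δ ∉ promiseLift (AC0Mod 2 ∩ Classes.P) :=
  gapSlice_not_mem_inter_P δ (gapSlice_not_mem_of_le_invSqrt hδ)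

/-- the diluted point against the uniform class `AC⁰[⊕] ∩ P` of the crux 27983 `RungA`. -/
theorem gapSlice_invExpSqrt_not_mem_inter_P : GapSlice invExpSqrt ∉ promiseLift (AC0Mod 2 ∩ Classes.P) :=
  gapSlice_not_mem_inter_P _ gapSlice_invExpSqrt_not_mem

/-- the honest pointwise form below the constant `3/5` of the route's target (`2^{-n/2} ≤ 3/5` fails at `n ∈ {0,1}`). -/
theorem gapSlice_min_threeFifths_invSqrt_not_mem :
    GapSlice (fun n => min (3 / 5 : ℝ) (invSqrt n)) ∉ promiseLift (AC0Mod 2) :=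
  gapSlice_not_mem_of_le_invSqrt fun n => min_le_right _ _

/-- CALIBRATION: the proved region `δ ≤ 2^{-√n}` and item 27991 (`δ = 1`) are two points of ONE antitone dial; the open cells are the
gaps in between (`2^{-n^ε}`, `1/poly`, constants `< 1`), each NECESSARY for 27991. -/
theorem dial_calibration :
    GapSlice invSqrt ∉ promiseLift (AC0Mod 2) ∧ GapSlice invExpSqrt ∉ promiseLift (AC0Mod 2) ∧
      (Summit.QuantumAdvantage.QuantumAdvantage.Theses.AnfPresentation.RungANonuniform ↔
        GapSlice (fun _ => (1 : ℝ)) ∉ promiseLift (AC0Mod 2)) ∧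
      (∀ (C : Set (Language Bool)) (δ δ' : ℕ → ℝ), (∀ n, δ n ≤ δ' n) →
        GapSlice δ' ∉ promiseLift C → GapSlice δ ∉ promiseLift C) :=
  ⟨gapSlice_invSqrt_not_mem, gapSlice_invExpSqrt_not_mem, anfPresentation_rungANonuniform_iff, fun _ _ _ h => gapSlice_not_mem_anti h⟩

end Proved

end Summit.QuantumAdvantage.QuantumAdvantage.Theorems.GapDial

end
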